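import Summits.ValiantsHypothesis.ValiantsHypothesis.Theorems.LacunarySymmetroidMatrixDescartesCensusRealExponentsDoorsShellsBrackets

/-!
# `MatrixDescartes` census — DOOR A at `(3,4)`: a failure of `DoorA34` is an OPEN condition in the LETTERS

HONEST FRAMING.  Object-search cell `pub-symmetroid`, door-A seat `val-sym-door-p3` (g9); item stmt-ValiantsHypothesis-19980
`DoorA34 = PosRootLawAt 3 4 18` (route item `Theses.LacunarySymmetroid.DoorA34`) is OPEN and asserted nowhere in this file.
`…CensusRealExponentsDoorsShellsBrackets` (door-p1) records that a failure of `DoorA34` is witnessed by `19` pairwise disjoint positive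
SIGN-CHANGE BRACKETS of one symmetric pencil.  Sign changes persist under small perturbations of the LETTERS, so:

* `le_card_posRoots_of_brackets` — IVT row for one polynomial: `n` disjoint positive sign-change brackets ⇒ `≥ n` distinct positive
  roots (of the SAME polynomial);
* `continuous_eval_det_pencil_letters` — `S ↦ det F_S(t)` is continuous in the `36` entries of the four letters (entrywise
  coordinates `E : Fin 4 → Fin 3 → Fin 3 → ℝ`, letters `Matrix.of (E l)`);
* `brackets_persist_letters` — sign-change brackets of `F_{E₀}` remain sign-change brackets of `F_E` for all `E` entrywise `ε`-close;
* **`exists_open_failure_of_not_doorA34`** — if `DoorA34` fails then for some support `d`, some symmetric letters `E₀` and some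
  `ε > 0`, EVERY quadruple of letters entrywise `ε`-close to `E₀` (symmetric or not) has `≥ 19` distinct positive det-roots.

Use (memo NODE-CHAMBERS-g9 §8): together with the density of node-form nets (generic real symmetric `(3,4)` nets are spanned by their
four rank-one members — NOT formalised) this makes the scalar `e₃`-bound of `…CensusDoorA34NodeScalar` EQUIVALENT to `DoorA34`.
Nothing here bounds `ζ_sym(3,4)`; `DoorA34` stays OPEN; nothing bears on `MatrixDescartes` (stmt-ValiantsHypothesis-18050) or on
`VP ≠ VNP`.  [folklore] IVT + continuity; elementary.
-/

-- `Summit.ValiantsHypothesis.ValiantsHypothesis.…` repeats a component by the D-0017 layout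
-- (single-conjunct summit), which the `dupNamespace` linter flags; the name is mandated.
set_option linter.dupNamespace false

namespace Summit.ValiantsHypothesis.ValiantsHypothesis.Theorems.LacunarySymmetroidMatrixDescartes.Census

open Polynomial Finset
open scoped BigOperators Polynomial Matrix Topology
open Summit.ValiantsHypothesis.ValiantsHypothesis.Theorems.SymmetroidDescartes (eval_det_pencil)

/-- **IVT row.**  `n` pairwise disjoint positive brackets `0 < aᵢ < bᵢ ≤ aᵢ₊₁` across each of which the real polynomial `P` changes
sign ⇒ `P` has at least `n` distinct positive roots. [folklore] -/
theorem le_card_posRoots_of_brackets (P : ℝ[X]) {n : ℕ} (a b : Fin n → ℝ) (hpos : ∀ i, 0 < a i)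
    (hab : ∀ i, a i < b i) (hdisj : ∀ i j, i < j → b i ≤ a j) (hsign : ∀ i, P.eval (a i) * P.eval (b i) < 0) :
    n ≤ (P.roots.toFinset.filter (fun x => 0 < x)).card := by
  classical
  have hroot : ∀ i, ∃ w ∈ Set.Ioo (a i) (b i), P.eval w = 0 := fun i =>
    RealExp.exists_zero_of_mul_neg (hab i) P.continuous.continuousOn (hsign i)
  choose w hwmem hw0 using hroot
  rcases Nat.eq_zero_or_pos n with hn | hn
  · omega
  have hP0 : P ≠ 0 := by
    intro h0
    have := hsign ⟨0, hn⟩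
    rw [h0, eval_zero, zero_mul] at this
    exact lt_irrefl _ this
  have hwmono : StrictMono w := by
    intro i j hij
    have h1 := (hwmem i).2; have h2 := (hwmem j).1; have h3 := hdisj i j hij
    linarith
  have hsub : univ.image w ⊆ P.roots.toFinset.filter (fun x => 0 < x) := by
    intro x hx
    rw [Finset.mem_image] at hx
    obtain ⟨i, -, rfl⟩ := hx
    rw [Finset.mem_filter, Multiset.mem_toFinset, mem_roots hP0, IsRoot.def]
    exact ⟨hw0 i, (hpos i).trans (hwmem i).1⟩
  have hcard := Finset.card_le_card hsub
  rw [Finset.card_image_of_injective _ hwmono.injective, Finset.card_univ, Fintype.card_fin] at hcard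
  exact hcard

/-- **Continuity in the letters.**  For fixed support `d` and point `t`, the determinant evaluation `det F_E(t)` of the pencil with
letters `Matrix.of (E l)` is a continuous (polynomial) function of the entry data `E : Fin 4 → Fin 3 → Fin 3 → ℝ`. [folklore] -/
theorem continuous_eval_det_pencil_letters (d : Fin 4 → ℕ) (t : ℝ) :
    Continuous fun E : Fin 4 → Fin 3 → Fin 3 → ℝ =>
      ((∑ l, (X : ℝ[X]) ^ d l • (Matrix.of (E l)).map C).det).eval t := by
  have h : (fun E : Fin 4 → Fin 3 → Fin 3 → ℝ => ((∑ l, (X : ℝ[X]) ^ d l • (Matrix.of (E l)).map C).det).eval t)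
      = fun E => (∑ l, t ^ d l • Matrix.of (E l)).det := by
    funext E
    exact eval_det_pencil _ _ _
  rw [h]
  simp only [Matrix.det_fin_three, Fin.sum_univ_four]
  fun_prop

/-- **Sign-change brackets persist under small perturbations of the letters.** [folklore] -/
theorem brackets_persist_letters (d : Fin 4 → ℕ) (E₀ : Fin 4 → Fin 3 → Fin 3 → ℝ) {n : ℕ} (a b : Fin n → ℝ)
    (hsign : ∀ i, ((∑ l, (X : ℝ[X]) ^ d l • (Matrix.of (E₀ l)).map C).det).eval (a i) *
      ((∑ l, (X : ℝ[X]) ^ d l • (Matrix.of (E₀ l)).map C).det).eval (b i) < 0) :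
    ∃ ε : ℝ, 0 < ε ∧ ∀ E : Fin 4 → Fin 3 → Fin 3 → ℝ, (∀ l i j, |E l i j - E₀ l i j| < ε) →
      ∀ i, ((∑ l, (X : ℝ[X]) ^ d l • (Matrix.of (E l)).map C).det).eval (a i) *
        ((∑ l, (X : ℝ[X]) ^ d l • (Matrix.of (E l)).map C).det).eval (b i) < 0 := by
  have hopen : IsOpen {E : Fin 4 → Fin 3 → Fin 3 → ℝ | ∀ i,
      ((∑ l, (X : ℝ[X]) ^ d l • (Matrix.of (E l)).map C).det).eval (a i) *
        ((∑ l, (X : ℝ[X]) ^ d l • (Matrix.of (E l)).map C).det).eval (b i) < 0} := by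
    rw [Set.setOf_forall]
    exact isOpen_iInter_of_finite fun i =>
      isOpen_lt ((continuous_eval_det_pencil_letters d (a i)).mul (continuous_eval_det_pencil_letters d (b i)))
        continuous_const
  obtain ⟨ε, hε, hball⟩ := Metric.isOpen_iff.mp hopen E₀ hsign
  refine ⟨ε, hε, fun E hE => ?_⟩
  have hmem : E ∈ Metric.ball E₀ ε := by
    rw [Metric.mem_ball, dist_pi_lt_iff hε]
    intro l
    rw [dist_pi_lt_iff hε]
    intro i
    rw [dist_pi_lt_iff hε]
    intro j
    rw [Real.dist_eq]
    exact hE l i j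
  exact hball hmem

/-- **A failure of `DoorA34` is an open condition in the letters.**  If `DoorA34` fails then there are a support `d : Fin 4 → ℕ`,
SYMMETRIC letters `E₀` and `ε > 0` such that EVERY quadruple of `3 × 3` letters entrywise `ε`-close to `E₀` — symmetric or not —
has at least `19` distinct positive det-roots on the support `d`.  (So a failure would be visible on any dense class of nets, e.g.
the node-form nets of `…CensusDoorA34NodeScalar` once their density is available.) [folklore] -/
theorem exists_open_failure_of_not_doorA34 (h : ¬ DoorA34) :
    ∃ (d : Fin 4 → ℕ) (E₀ : Fin 4 → Fin 3 → Fin 3 → ℝ), (∀ l, (Matrix.of (E₀ l)).IsSymm) ∧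
      ∃ ε : ℝ, 0 < ε ∧ ∀ E : Fin 4 → Fin 3 → Fin 3 → ℝ, (∀ l i j, |E l i j - E₀ l i j| < ε) →
        19 ≤ (((∑ l, (X : ℝ[X]) ^ d l • (Matrix.of (E l)).map C).det).roots.toFinset.filter
          (fun t => 0 < t)).card := by
  obtain ⟨d, S, hS, n, hn, a, b, hpos, hab, hdisj, hsign⟩ := RealExp.exists_brackets_of_not_doorA34 h
  refine ⟨d, fun l i j => S l i j, fun l => hS l, ?_⟩
  obtain ⟨ε, hε, hper⟩ := brackets_persist_letters d (fun l i j => S l i j) a b (fun i => hsign i)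
  exact ⟨ε, hε, fun E hE => hn.trans (le_card_posRoots_of_brackets _ a b hpos hab hdisj (hper E hE))⟩

end Summit.ValiantsHypothesis.ValiantsHypothesis.Theorems.LacunarySymmetroidMatrixDescartes.Census
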